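import Literature.AlgebraicGeometry.Motives.HodgeLieProductSimpleFactor
import Literature.Algebra.Lie.GoursatSemisimple
import HarnessLib

/-!
# `𝔥(H₁ ⊕ H₂) = 𝔥(H₁) × 𝔥(H₂)` when the factors are `Θ`-rigid and `𝔥(H₁)`, `𝔥(H₂)` have NO COMMON SIMPLE FACTOR
# (Moonen–Zarhin 1999 §3 (3.1) `𝔥𝔤(X₁) ≅ 𝔤₁ ⊕ 𝔤₃`, `𝔥𝔤(X₂) ≅ 𝔤₂ ⊕ 𝔤₃`, `𝔥𝔤(X₁ × X₂) ≅ 𝔤₁ ⊕ 𝔤₂ ⊕ Γ_φ`; Lie form, via Goursat)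

Family `hodge`, layer `Literature/AlgebraicGeometry/Motives`; THEOREMS ONLY (no definition, no instance, no named fact).  Sequel of
`Motives/HodgeLieProductSimpleFactor` (there: `𝔥(H₁)` SIMPLE, and the sum formula under dimension constraints) written by the lane
`lit-hodgefound` (Track 2 foundations library; seat p17, generation 40, row g40-#6) as the Hodge consumer of the general Goursat
lemma `Literature/Algebra/Lie/GoursatLemma` and its reductive ∕ semisimple form `Literature/Algebra/Lie/GoursatSemisimple`.

SETTING (verbatim the sibling's).  `H ≅ H₁ ⊕ H₂` a pure `ℚ`-Hodge structure decomposed by morphisms `ι_i : H_i → H`, `π_i : H → H_i`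
(`π_i ι_i = id`, `ι₁ π₁ + ι₂ π₂ = id`); `Θ`-RIGIDITY `hrig_i` of both factors (every bracket-closed rational subspace of `𝔥(H_i)` whose
complex span contains a Hodge operator contains `𝔥(H_i)`; PROVED in the tree for the factors that occur, sibling §4); Lie
subalgebras `𝔏 ⊆ 𝔤𝔩(V)`, `𝔏_i ⊆ 𝔤𝔩(V_i)` with carriers `𝔥(H)`, `𝔥(H_i)` (hypotheses `X ∈ 𝔏 ↔ X ∈ 𝔥(H)`; such `𝔏` exist:
`exists_lieSubalgebra_eq_hodgeLie`; the Lie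
structure on `𝔤𝔩 = Module.End ℚ V` is Mathlib's `LieRing.ofAssociativeRing`, written explicitly in the binders since it is not a
global instance).

* §1 **`exists_lieHom_surjective_of_rigid`** — the GOURSAT POSITION of `𝔥(H)`: the restrictions `r₁ : 𝔏 → 𝔏₁`, `r₂ : 𝔏 → 𝔏₂`
  (`X ↦ π_i X ι_i`) are SURJECTIVE Lie homomorphisms with `ker r₁ ⊓ ker r₂ = 0` (Moonen–Zarhin: «`Hg(X)` is an algebraic subgroup of
  `Hg(X₁) × Hg(X₂)`. The two projections are surjective»); packaged once from the sibling's §1–§2.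
* §2 Consequences through `GoursatLemma`: `finrank_hodgeLie_le_add_of_rigid` (`dim 𝔥(H) ≤ dim 𝔥(H₁) + dim 𝔥(H₂)`),
  **`nonempty_lieEquiv_prod_of_rigid_of_finrank_eq_add`** (equality ⟹ `𝔥(H) ≅ 𝔥(H₁) × 𝔥(H₂)` as Lie algebras),
  `finrank_hodgeLie_eq_add_of_rigid_of_forall_isEmpty_lieEquiv_quotient` (no proper quotient of `𝔥(H₁)` is isomorphic to a quotient
  of `𝔥(H₂)` ⟹ equality).
* §3 Consequences through `GoursatSemisimple`: **`finrank_hodgeLie_eq_add_of_rigid_of_forall_isSimple_isEmpty_lieEquiv`**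
  (`𝔥(H₁)`, `𝔥(H₂)` SEMISIMPLE with no simple ideal of one isomorphic to a simple ideal of the other ⟹
  `dim 𝔥(H) = dim 𝔥(H₁) + dim 𝔥(H₂)`), `finrank_hodgeLie_eq_add_of_rigid_of_isSimple_of_isEmpty_lieEquiv` (both simple and
  non-isomorphic — no dimension hypothesis), `finrank_hodgeLie_eq_add_of_rigid_of_forall_ne_bot_isEmpty_lieEquiv` (`𝔥(H₁)`, `𝔥(H₂)`
  REDUCTIVE with no non-zero ideal of one isomorphic to an ideal of the other), and Moonen–Zarhin's structure statement
  **`exists_isCompl_and_lieEquiv_of_rigid`** (reductive factors: `𝔥(H₁) = 𝔫₁ ⊕ C₁`, `𝔥(H₂) = 𝔫₂ ⊕ C₂`, `C₁ ≅ C₂` — their `𝔤₃`).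

## References

* [MoonenZarhin1999LowDim] B. Moonen, Yu. G. Zarhin, *Hodge classes on abelian varieties of low dimension*, Math. Ann. 315 (1999),
  §3 (3.1) [corpus: paper:arxiv-math_9901113 p. 6, L24–L45]. [cite: MoonenZarhin1999LowDim, §3 (3.1)]
* [Hazama1983] F. Hazama, Tôhoku Math. J. 35 (1983), §3 Lemma (3.1) (Goursat's lemma for Lie algebras). [cite: Hazama1983, Lemma (3.1)]
* [Gordon1997] B. B. Gordon, *A survey of the Hodge conjecture for abelian varieties*, §2.16 Proposition (Goursat's Lemma)
  [corpus: paper:arxiv-alg-geom_9709030 p. 12]. [cite: Gordon1997, §2.16 Proposition]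
* [Deligne1982HodgeCycles] P. Deligne, *Hodge cycles on abelian varieties*, LNM 900 (1982), I §3.1 and Prop. 3.4.
-/

noncomputable section

namespace Literature.AlgebraicGeometry.Motives

namespace HodgeStructure

open Literature.Algebra.Lie

universe u

/-- `dim 𝔏 = dim S` for a Lie subalgebra `𝔏 ⊆ 𝔤𝔩` (commutator bracket) with carrier the subspace `S`. [folklore] -/
private theorem finrank_eq_of_forall_mem_iff {R M : Type*} [CommRing R] [Ring M] [Algebra R M]
    (𝔏 : @LieSubalgebra R M _ LieRing.ofAssociativeRing LieAlgebra.ofAssociativeAlgebra) (S : Submodule R M)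
    (h : ∀ X, X ∈ 𝔏 ↔ X ∈ S) : Module.finrank R 𝔏 = Module.finrank R S := by
  letI : LieRing M := LieRing.ofAssociativeRing
  letI : LieAlgebra R M := LieAlgebra.ofAssociativeAlgebra
  have h' : 𝔏.toSubmodule = S := Submodule.ext h
  rw [← h']
  rfl

/-- A Lie subalgebra of a finite-dimensional `𝔤𝔩` is finite-dimensional. [folklore] -/
private theorem moduleFinite_of_lieSubalgebra {R M : Type*} [CommRing R] [Ring M] [Algebra R M] [Module.Finite R M]
    [IsNoetherianRing R] (𝔏 : @LieSubalgebra R M _ LieRing.ofAssociativeRing LieAlgebra.ofAssociativeAlgebra) :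
    Module.Finite R 𝔏 := by
  letI : LieRing M := LieRing.ofAssociativeRing
  letI : LieAlgebra R M := LieAlgebra.ofAssociativeAlgebra
  exact Module.Finite.of_injective 𝔏.toSubmodule.subtype Subtype.val_injective

variable {V₁ : Type u} [AddCommGroup V₁] [Module ℚ V₁] [Module.Finite ℚ V₁]
  {V₂ : Type u} [AddCommGroup V₂] [Module ℚ V₂] [Module.Finite ℚ V₂]
  {V : Type u} [AddCommGroup V] [Module ℚ V] [Module.Finite ℚ V] [HodgeTensorFacts.{u, u}] {n : ℤ}
  {H₁ : HodgeStructure V₁ n} {H₂ : HodgeStructure V₂ n} {H : HodgeStructure V n}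

section Main

variable (ι₁ : Hom H₁ H) (π₁ : Hom H H₁) (ι₂ : Hom H₂ H) (π₂ : Hom H H₂)
  (hπι₁ : ∀ v, π₁.toLinearMap (ι₁.toLinearMap v) = v) (hπι₂ : ∀ v, π₂.toLinearMap (ι₂.toLinearMap v) = v)
  (hsum : ∀ v, ι₁.toLinearMap (π₁.toLinearMap v) + ι₂.toLinearMap (π₂.toLinearMap v) = v)
  (hrig₁ : ∀ 𝔞 : Submodule ℚ (Module.End ℚ V₁), 𝔞 ≤ H₁.hodgeLie →
      (∀ X ∈ 𝔞, ∀ Y ∈ 𝔞, X * Y - Y * X ∈ 𝔞) →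
      (∃ Θ ∈ Submodule.span ℂ ((fun X : Module.End ℚ V₁ => X.baseChange ℂ) '' (𝔞 : Set (Module.End ℚ V₁))),
        ∀ p, ∀ x ∈ H₁.piece p (n - p), Θ x = ((2 * p - n : ℤ) : ℂ) • x) → H₁.hodgeLie ≤ 𝔞)
  (hrig₂ : ∀ 𝔞 : Submodule ℚ (Module.End ℚ V₂), 𝔞 ≤ H₂.hodgeLie →
      (∀ X ∈ 𝔞, ∀ Y ∈ 𝔞, X * Y - Y * X ∈ 𝔞) →
      (∃ Θ ∈ Submodule.span ℂ ((fun X : Module.End ℚ V₂ => X.baseChange ℂ) '' (𝔞 : Set (Module.End ℚ V₂))),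
        ∀ p, ∀ x ∈ H₂.piece p (n - p), Θ x = ((2 * p - n : ℤ) : ℂ) • x) → H₂.hodgeLie ≤ 𝔞)
  (𝔏 : @LieSubalgebra ℚ (Module.End ℚ V) _ LieRing.ofAssociativeRing LieAlgebra.ofAssociativeAlgebra)
  (h𝔏 : ∀ X, X ∈ 𝔏 ↔ X ∈ H.hodgeLie)
  (𝔏₁ : @LieSubalgebra ℚ (Module.End ℚ V₁) _ LieRing.ofAssociativeRing LieAlgebra.ofAssociativeAlgebra)
  (h𝔏₁ : ∀ X, X ∈ 𝔏₁ ↔ X ∈ H₁.hodgeLie)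
  (𝔏₂ : @LieSubalgebra ℚ (Module.End ℚ V₂) _ LieRing.ofAssociativeRing LieAlgebra.ofAssociativeAlgebra)
  (h𝔏₂ : ∀ X, X ∈ 𝔏₂ ↔ X ∈ H₂.hodgeLie)

/-! ### §1 The Goursat position of `𝔥(H₁ ⊕ H₂)` -/

include hπι₁ hπι₂ hsum hrig₁ hrig₂ h𝔏 h𝔏₁ h𝔏₂ in
/-- **The Goursat position of `𝔥(H)` in `𝔥(H₁) × 𝔥(H₂)`** (`Θ`-rigid factors): the restrictions `r_i : 𝔥(H) → 𝔥(H_i)`,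
`X ↦ π_i X ι_i`, are SURJECTIVE homomorphisms of Lie algebras, JOINTLY INJECTIVE (`X = ι₁ r₁(X) π₁ + ι₂ r₂(X) π₂`).  (Moonen–Zarhin:
«`Hg(X)` is an algebraic subgroup of `Hg(X₁) × Hg(X₂)`. The two projections `pr_i` are surjective.»)
[cite: MoonenZarhin1999LowDim, §3 (3.1)] [cite: Deligne1982HodgeCycles, I §3.1 and Prop. 3.4] -/
theorem exists_lieHom_surjective_of_rigid :
    ∃ (f : 𝔏 →ₗ⁅ℚ⁆ 𝔏₁) (g : 𝔏 →ₗ⁅ℚ⁆ 𝔏₂), Function.Surjective f ∧ Function.Surjective g ∧ f.ker ⊓ g.ker = ⊥ ∧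
      (∀ X : 𝔏, ((f X : 𝔏₁) : Module.End ℚ V₁) = π₁.toLinearMap ∘ₗ (X : Module.End ℚ V) ∘ₗ ι₁.toLinearMap) ∧
      (∀ X : 𝔏, ((g X : 𝔏₂) : Module.End ℚ V₂) = π₂.toLinearMap ∘ₗ (X : Module.End ℚ V) ∘ₗ ι₂.toLinearMap) := by
  letI : LieRing (Module.End ℚ V) := LieRing.ofAssociativeRing
  letI : LieAlgebra ℚ (Module.End ℚ V) := LieAlgebra.ofAssociativeAlgebra
  letI : LieRing (Module.End ℚ V₁) := LieRing.ofAssociativeRing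
  letI : LieAlgebra ℚ (Module.End ℚ V₁) := LieAlgebra.ofAssociativeAlgebra
  letI : LieRing (Module.End ℚ V₂) := LieRing.ofAssociativeRing
  letI : LieAlgebra ℚ (Module.End ℚ V₂) := LieAlgebra.ofAssociativeAlgebra
  have h𝔏' : 𝔏.toSubmodule = H.hodgeLie := Submodule.ext fun X ↦ h𝔏 X
  have h𝔏₁' : 𝔏₁.toSubmodule = H₁.hodgeLie := Submodule.ext fun X ↦ h𝔏₁ X
  have h𝔏₂' : 𝔏₂.toSubmodule = H₂.hodgeLie := Submodule.ext fun X ↦ h𝔏₂ X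
  obtain ⟨f, hf⟩ := exists_lieHom_restrict ι₁ π₁ hπι₁ 𝔏 h𝔏' 𝔏₁ h𝔏₁'
  obtain ⟨g, hg⟩ := exists_lieHom_restrict ι₂ π₂ hπι₂ 𝔏 h𝔏' 𝔏₂ h𝔏₂'
  have hmem : ∀ X : 𝔏, (X : Module.End ℚ V) ∈ H.hodgeLie := fun X => (h𝔏 X).1 X.2
  have hfs : Function.Surjective f := by
    rintro ⟨Y, hY⟩
    obtain ⟨X, hX, hXY⟩ := exists_restrict_eq_of_rigid ι₁ π₁ hπι₁ hrig₁ ((h𝔏₁ Y).1 hY)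
    refine ⟨⟨X, (h𝔏 X).2 hX⟩, Subtype.ext ?_⟩
    rw [hf]; exact hXY
  have hgs : Function.Surjective g := by
    rintro ⟨Y, hY⟩
    obtain ⟨X, hX, hXY⟩ := exists_restrict_eq_of_rigid ι₂ π₂ hπι₂ hrig₂ ((h𝔏₂ Y).1 hY)
    refine ⟨⟨X, (h𝔏 X).2 hX⟩, Subtype.ext ?_⟩
    rw [hg]; exact hXY
  have hker : f.ker ⊓ g.ker = ⊥ := by
    rw [eq_bot_iff]
    intro X hX
    rw [LieSubmodule.mem_inf, LieHom.mem_ker, LieHom.mem_ker] at hX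
    rw [LieSubmodule.mem_bot]
    apply Subtype.ext
    have h1 : π₁.toLinearMap ∘ₗ (X : Module.End ℚ V) ∘ₗ ι₁.toLinearMap = 0 := by
      rw [← hf, hX.1]; rfl
    have h2 : π₂.toLinearMap ∘ₗ (X : Module.End ℚ V) ∘ₗ ι₂.toLinearMap = 0 := by
      rw [← hg, hX.2]; rfl
    have h := eq_sum_blocks_of_mem_hodgeLie ι₁ π₁ ι₂ π₂ hπι₁ hπι₂ hsum (hmem X)
    rw [h1, h2, LinearMap.zero_comp, LinearMap.comp_zero, LinearMap.zero_comp, LinearMap.comp_zero, add_zero] at h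
    exact h
  exact ⟨f, g, hfs, hgs, hker, hf, hg⟩

/-! ### §2 Through the general Goursat lemma -/

include hπι₁ hπι₂ hsum hrig₁ hrig₂ h𝔏 h𝔏₁ h𝔏₂ in
/-- **`dim 𝔥(H₁ ⊕ H₂) ≤ dim 𝔥(H₁) + dim 𝔥(H₂)`** for `Θ`-rigid factors (`(r₁, r₂)` is injective).
[cite: MoonenZarhin1999LowDim, §3 (3.1)] [cite: Gordon1997, §2.16 Proposition] -/
theorem finrank_hodgeLie_le_add_of_rigid :
    Module.finrank ℚ H.hodgeLie ≤ Module.finrank ℚ H₁.hodgeLie + Module.finrank ℚ H₂.hodgeLie := by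
  obtain ⟨f, g, hfs, hgs, hker, -, -⟩ :=
    exists_lieHom_surjective_of_rigid ι₁ π₁ ι₂ π₂ hπι₁ hπι₂ hsum hrig₁ hrig₂ 𝔏 h𝔏 𝔏₁ h𝔏₁ 𝔏₂ h𝔏₂
  haveI : Module.Finite ℚ 𝔏 := moduleFinite_of_lieSubalgebra 𝔏
  haveI : Module.Finite ℚ 𝔏₁ := moduleFinite_of_lieSubalgebra 𝔏₁
  rw [← finrank_eq_of_forall_mem_iff 𝔏 H.hodgeLie h𝔏, ← finrank_eq_of_forall_mem_iff 𝔏₁ H₁.hodgeLie h𝔏₁,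
    ← finrank_eq_of_forall_mem_iff 𝔏₂ H₂.hodgeLie h𝔏₂]
  exact GoursatLemma.finrank_le_add f g hfs hgs hker

include hπι₁ hπι₂ hsum hrig₁ hrig₂ h𝔏 h𝔏₁ h𝔏₂ in
/-- **Equality `dim 𝔥(H) = dim 𝔥(H₁) + dim 𝔥(H₂)` means `𝔥(H) ≅ 𝔥(H₁) × 𝔥(H₂)` as Lie algebras** (`(r₁, r₂)` is then
bijective). [cite: MoonenZarhin1999LowDim, §3 (3.1)] [cite: Hazama1983, Lemma (3.1)] -/
theorem nonempty_lieEquiv_prod_of_rigid_of_finrank_eq_add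
    (h : Module.finrank ℚ H.hodgeLie = Module.finrank ℚ H₁.hodgeLie + Module.finrank ℚ H₂.hodgeLie) :
    Nonempty (𝔏 ≃ₗ⁅ℚ⁆ 𝔏₁ × 𝔏₂) := by
  obtain ⟨f, g, hfs, hgs, hker, -, -⟩ :=
    exists_lieHom_surjective_of_rigid ι₁ π₁ ι₂ π₂ hπι₁ hπι₂ hsum hrig₁ hrig₂ 𝔏 h𝔏 𝔏₁ h𝔏₁ 𝔏₂ h𝔏₂
  haveI : Module.Finite ℚ 𝔏 := moduleFinite_of_lieSubalgebra 𝔏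
  haveI : Module.Finite ℚ 𝔏₁ := moduleFinite_of_lieSubalgebra 𝔏₁
  rw [← finrank_eq_of_forall_mem_iff 𝔏 H.hodgeLie h𝔏, ← finrank_eq_of_forall_mem_iff 𝔏₁ H₁.hodgeLie h𝔏₁,
    ← finrank_eq_of_forall_mem_iff 𝔏₂ H₂.hodgeLie h𝔏₂] at h
  exact ⟨LieEquiv.ofBijective (f.prod g) ((GoursatLemma.finrank_eq_add_iff_bijective_prod f g hfs hgs hker).1 h)⟩

include hπι₁ hπι₂ hsum hrig₁ hrig₂ h𝔏 h𝔏₁ h𝔏₂ in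
/-- **No proper quotient of `𝔥(H₁)` is isomorphic to a quotient of `𝔥(H₂)` ⟹ `dim 𝔥(H) = dim 𝔥(H₁) + dim 𝔥(H₂)`** (Goursat:
otherwise `𝔥(H₁) ⧸ 𝔫₁ ≅ 𝔥(H₂) ⧸ 𝔫₂` with `𝔫₁ ≠ 𝔥(H₁)`). [cite: Gordon1997, §2.16 Proposition] [cite: MoonenZarhin1999LowDim, §3 (3.1)] -/
theorem finrank_hodgeLie_eq_add_of_rigid_of_forall_isEmpty_lieEquiv_quotient
    (h : ∀ I : LieIdeal ℚ 𝔏₁, I ≠ ⊤ → ∀ J : LieIdeal ℚ 𝔏₂, IsEmpty ((𝔏₁ ⧸ I) ≃ₗ⁅ℚ⁆ (𝔏₂ ⧸ J))) :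
    Module.finrank ℚ H.hodgeLie = Module.finrank ℚ H₁.hodgeLie + Module.finrank ℚ H₂.hodgeLie := by
  obtain ⟨f, g, hfs, hgs, hker, -, -⟩ :=
    exists_lieHom_surjective_of_rigid ι₁ π₁ ι₂ π₂ hπι₁ hπι₂ hsum hrig₁ hrig₂ 𝔏 h𝔏 𝔏₁ h𝔏₁ 𝔏₂ h𝔏₂
  haveI : Module.Finite ℚ 𝔏 := moduleFinite_of_lieSubalgebra 𝔏
  haveI : Module.Finite ℚ 𝔏₁ := moduleFinite_of_lieSubalgebra 𝔏₁
  rw [← finrank_eq_of_forall_mem_iff 𝔏 H.hodgeLie h𝔏, ← finrank_eq_of_forall_mem_iff 𝔏₁ H₁.hodgeLie h𝔏₁,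
    ← finrank_eq_of_forall_mem_iff 𝔏₂ H₂.hodgeLie h𝔏₂]
  exact (GoursatLemma.finrank_eq_add_iff_map_ker_eq_top f g hfs hgs hker).2
    (GoursatLemma.map_ker_eq_top_of_forall_isEmpty_lieEquiv f g hfs hgs h)

/-! ### §3 Semisimple and reductive Hodge Lie algebras: no common simple factor -/

include hπι₁ hπι₂ hsum hrig₁ hrig₂ h𝔏 h𝔏₁ h𝔏₂ in
/-- **`dim 𝔥(H₁ ⊕ H₂) = dim 𝔥(H₁) + dim 𝔥(H₂)` — i.e. `𝔥(H₁ ⊕ H₂) = 𝔥(H₁) × 𝔥(H₂)` — for `Θ`-rigid factors whose Hodge Lie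
algebras are SEMISIMPLE WITH NO COMMON SIMPLE FACTOR** (no simple ideal of `𝔥(H₁)` is isomorphic, as a `ℚ`-Lie algebra, to a
simple ideal of `𝔥(H₂)`): Goursat's lemma in the form `GoursatSemisimple.finrank_eq_add_of_forall_isSimple_isEmpty_lieEquiv`.
[cite: MoonenZarhin1999LowDim, §3 (3.1)] [cite: Hazama1983, Lemma (3.1)] [cite: Gordon1997, §2.16 Proposition] -/
theorem finrank_hodgeLie_eq_add_of_rigid_of_forall_isSimple_isEmpty_lieEquiv
    [LieAlgebra.IsSemisimple ℚ 𝔏₁] [LieAlgebra.IsSemisimple ℚ 𝔏₂]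
    (h : ∀ (A : LieIdeal ℚ 𝔏₁) (B : LieIdeal ℚ 𝔏₂), LieAlgebra.IsSimple ℚ A → LieAlgebra.IsSimple ℚ B → IsEmpty (A ≃ₗ⁅ℚ⁆ B)) :
    Module.finrank ℚ H.hodgeLie = Module.finrank ℚ H₁.hodgeLie + Module.finrank ℚ H₂.hodgeLie := by
  obtain ⟨f, g, hfs, hgs, hker, -, -⟩ :=
    exists_lieHom_surjective_of_rigid ι₁ π₁ ι₂ π₂ hπι₁ hπι₂ hsum hrig₁ hrig₂ 𝔏 h𝔏 𝔏₁ h𝔏₁ 𝔏₂ h𝔏₂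
  haveI : Module.Finite ℚ 𝔏 := moduleFinite_of_lieSubalgebra 𝔏
  haveI : Module.Finite ℚ 𝔏₁ := moduleFinite_of_lieSubalgebra 𝔏₁
  rw [← finrank_eq_of_forall_mem_iff 𝔏 H.hodgeLie h𝔏, ← finrank_eq_of_forall_mem_iff 𝔏₁ H₁.hodgeLie h𝔏₁,
    ← finrank_eq_of_forall_mem_iff 𝔏₂ H₂.hodgeLie h𝔏₂]
  exact GoursatSemisimple.finrank_eq_add_of_forall_isSimple_isEmpty_lieEquiv f g hfs hgs hker h

include hπι₁ hπι₂ hsum hrig₁ hrig₂ h𝔏 h𝔏₁ h𝔏₂ in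
/-- **Both `𝔥(H₁)`, `𝔥(H₂)` SIMPLE and NOT ISOMORPHIC ⟹ `dim 𝔥(H₁ ⊕ H₂) = dim 𝔥(H₁) + dim 𝔥(H₂)`** (no dimension hypothesis;
Gordon §2.16: "either `𝔰 = 𝔰₁ × 𝔰₂` or `𝔰` is the graph of an isomorphism `𝔰₁ ≅ 𝔰₂`").  A simple ideal of a simple Lie
algebra is the whole algebra (`⊤ ≃ₗ⁅ℚ⁆ 𝔏_i`, Mathlib `LieIdeal.topEquiv`). [cite: Gordon1997, §2.16 Proposition]
[cite: MoonenZarhin1999LowDim, §3 (3.1)] -/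
theorem finrank_hodgeLie_eq_add_of_rigid_of_isSimple_of_isEmpty_lieEquiv
    [LieAlgebra.IsSimple ℚ 𝔏₁] [LieAlgebra.IsSimple ℚ 𝔏₂] (h : IsEmpty (𝔏₁ ≃ₗ⁅ℚ⁆ 𝔏₂)) :
    Module.finrank ℚ H.hodgeLie = Module.finrank ℚ H₁.hodgeLie + Module.finrank ℚ H₂.hodgeLie := by
  refine finrank_hodgeLie_eq_add_of_rigid_of_forall_isSimple_isEmpty_lieEquiv ι₁ π₁ ι₂ π₂ hπι₁ hπι₂ hsum hrig₁ hrig₂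
    𝔏 h𝔏 𝔏₁ h𝔏₁ 𝔏₂ h𝔏₂ fun A B hA hB ↦ ⟨fun e ↦ h.false ?_⟩
  -- `A = ⊤` and `B = ⊤`: a simple ideal is non-zero, and the algebras are simple
  have hA' : A = ⊤ := by
    rcases LieAlgebra.IsSimple.eq_bot_or_eq_top A with h0 | h1
    · exfalso
      haveI : Subsingleton A := ⟨fun x y ↦ Subtype.ext (by
        have hx : (x : 𝔏₁) ∈ (⊥ : LieIdeal ℚ 𝔏₁) := h0 ▸ x.2
        have hy : (y : 𝔏₁) ∈ (⊥ : LieIdeal ℚ 𝔏₁) := h0 ▸ y.2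
        rw [LieSubmodule.mem_bot] at hx hy
        rw [hx, hy])⟩
      exact LieAlgebra.not_isSimple_of_subsingleton (R := ℚ) (L := A) hA
    · exact h1
  have hB' : B = ⊤ := by
    rcases LieAlgebra.IsSimple.eq_bot_or_eq_top B with h0 | h1
    · exfalso
      haveI : Subsingleton B := ⟨fun x y ↦ Subtype.ext (by
        have hx : (x : 𝔏₂) ∈ (⊥ : LieIdeal ℚ 𝔏₂) := h0 ▸ x.2
        have hy : (y : 𝔏₂) ∈ (⊥ : LieIdeal ℚ 𝔏₂) := h0 ▸ y.2
        rw [LieSubmodule.mem_bot] at hx hy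
        rw [hx, hy])⟩
      exact LieAlgebra.not_isSimple_of_subsingleton (R := ℚ) (L := B) hB
    · exact h1
  subst hA' hB'
  exact LieIdeal.topEquiv.symm.trans (e.trans LieIdeal.topEquiv)

include hπι₁ hπι₂ hsum hrig₁ hrig₂ h𝔏 h𝔏₁ h𝔏₂ in
/-- **REDUCTIVE `𝔥(H₁)`, `𝔥(H₂)` with no non-zero ideal of `𝔥(H₁)` isomorphic to an ideal of `𝔥(H₂)` ⟹
`dim 𝔥(H₁ ⊕ H₂) = dim 𝔥(H₁) + dim 𝔥(H₂)`** (every ideal of a reductive Lie algebra is a direct factor, and Goursat: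
`GoursatSemisimple.finrank_eq_add_of_forall_ne_bot_isEmpty_lieEquiv`). [cite: MoonenZarhin1999LowDim, §3 (3.1)]
[cite: Hazama1983, Lemma (3.1)] -/
theorem finrank_hodgeLie_eq_add_of_rigid_of_forall_ne_bot_isEmpty_lieEquiv
    [LieAlgebra.HasCentralRadical ℚ 𝔏₁] [LieAlgebra.HasCentralRadical ℚ 𝔏₂]
    (h : ∀ I : LieIdeal ℚ 𝔏₁, I ≠ ⊥ → ∀ J : LieIdeal ℚ 𝔏₂, IsEmpty (I ≃ₗ⁅ℚ⁆ J)) :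
    Module.finrank ℚ H.hodgeLie = Module.finrank ℚ H₁.hodgeLie + Module.finrank ℚ H₂.hodgeLie := by
  obtain ⟨f, g, hfs, hgs, hker, -, -⟩ :=
    exists_lieHom_surjective_of_rigid ι₁ π₁ ι₂ π₂ hπι₁ hπι₂ hsum hrig₁ hrig₂ 𝔏 h𝔏 𝔏₁ h𝔏₁ 𝔏₂ h𝔏₂
  haveI : Module.Finite ℚ 𝔏 := moduleFinite_of_lieSubalgebra 𝔏
  haveI : Module.Finite ℚ 𝔏₁ := moduleFinite_of_lieSubalgebra 𝔏₁
  haveI : Module.Finite ℚ 𝔏₂ := moduleFinite_of_lieSubalgebra 𝔏₂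
  rw [← finrank_eq_of_forall_mem_iff 𝔏 H.hodgeLie h𝔏, ← finrank_eq_of_forall_mem_iff 𝔏₁ H₁.hodgeLie h𝔏₁,
    ← finrank_eq_of_forall_mem_iff 𝔏₂ H₂.hodgeLie h𝔏₂]
  exact GoursatSemisimple.finrank_eq_add_of_forall_ne_bot_isEmpty_lieEquiv f g hfs hgs hker h

include hπι₁ hπι₂ hsum hrig₁ hrig₂ h𝔏 h𝔏₁ h𝔏₂ in
/-- **Moonen–Zarhin (3.1) for `𝔥(H₁ ⊕ H₂)` with REDUCTIVE `𝔥(H₁)`, `𝔥(H₂)`**: with the restrictions `r₁`, `r₂` of §1 and the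
Goursat ideals `𝔫₁ = r₁(ker r₂)` (`= 𝔤₁`), `𝔫₂ = r₂(ker r₁)` (`= 𝔤₂`), there are complementary ideals `𝔥(H₁) = 𝔫₁ ⊕ C₁`,
`𝔥(H₂) = 𝔫₂ ⊕ C₂` and an isomorphism `e : C₁ ≅ C₂` (`= 𝔤₃`) over whose graph `𝔥(H)` lies:
`r₁ X ≡ c (mod 𝔫₁) ⟹ r₂ X ≡ e c (mod 𝔫₂)`. [cite: MoonenZarhin1999LowDim, §3 (3.1)] -/
theorem exists_isCompl_and_lieEquiv_of_rigid [LieAlgebra.HasCentralRadical ℚ 𝔏₁] [LieAlgebra.HasCentralRadical ℚ 𝔏₂] :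
    ∃ (f : 𝔏 →ₗ⁅ℚ⁆ 𝔏₁) (g : 𝔏 →ₗ⁅ℚ⁆ 𝔏₂),
      (∀ X : 𝔏, ((f X : 𝔏₁) : Module.End ℚ V₁) = π₁.toLinearMap ∘ₗ (X : Module.End ℚ V) ∘ₗ ι₁.toLinearMap) ∧
      (∀ X : 𝔏, ((g X : 𝔏₂) : Module.End ℚ V₂) = π₂.toLinearMap ∘ₗ (X : Module.End ℚ V) ∘ₗ ι₂.toLinearMap) ∧
      ∃ (C₁ : LieIdeal ℚ 𝔏₁) (C₂ : LieIdeal ℚ 𝔏₂), IsCompl (LieIdeal.map f g.ker) C₁ ∧ IsCompl (LieIdeal.map g f.ker) C₂ ∧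
        ∃ e : C₁ ≃ₗ⁅ℚ⁆ C₂, ∀ (X : 𝔏) (c : C₁), f X - c ∈ LieIdeal.map f g.ker → g X - (e c : 𝔏₂) ∈ LieIdeal.map g f.ker := by
  obtain ⟨f, g, hfs, hgs, -, hf, hg⟩ :=
    exists_lieHom_surjective_of_rigid ι₁ π₁ ι₂ π₂ hπι₁ hπι₂ hsum hrig₁ hrig₂ 𝔏 h𝔏 𝔏₁ h𝔏₁ 𝔏₂ h𝔏₂
  haveI : Module.Finite ℚ 𝔏₁ := moduleFinite_of_lieSubalgebra 𝔏₁
  haveI : Module.Finite ℚ 𝔏₂ := moduleFinite_of_lieSubalgebra 𝔏₂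
  exact ⟨f, g, hf, hg, GoursatSemisimple.exists_isCompl_and_lieEquiv f g hfs hgs⟩

end Main

end HodgeStructure

end Literature.AlgebraicGeometry.Motives
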